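import Mathlib
import Summits.Schanuel.Schanuel.Statement
import Summits.Schanuel.Schanuel.Theorems.SoloBlindRoyWindow
import Summits.Schanuel.Schanuel.Theorems.SoloBlindPhilipponGaGmOne
import Literature.NumberTheory.Transcendental.RoyCriterion
import HarnessLib

/-!
# Common zeros of Roy's orbit family are torsion points (solo-Schanuel-blind, Lemma CZ)

Roy's Conjecture 2 [Roy2001] (`RoyCriterion l`, equivalent to Schanuel's conjecture for rank `l`)
feeds, for each large `N`, one polynomial `P_N ∈ ℤ[X₀, X₁]` of bidegree `≤ (N^{t₀}, N^{t₁})` whose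
derivatives `D^k P_N` (`D = ∂/∂X₀ + X₁∂/∂X₁`, `k ≤ N^{s₀}`) are small at the orbit points
`(∑ mⱼyⱼ, ∏ αⱼ^{mⱼ})`, `0 ≤ mⱼ ≤ N^{s₁}`. Any attempt to close the criterion with a criterion for
algebraic independence (Philippon 1986, Thm 2.11, vendored as `Philippon1986_mainCriterion`) must
apply it to the **orbit family** `Q_{k,m}(Y, A) = (D^k P_N)(∑ mⱼYⱼ, ∏ Aⱼ^{mⱼ}) ∈ ℤ[Y, A]` at the
point `θ = (y, α) ∈ ℂ^{2l}`, and such criteria ask for control of the common zeros of the family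
near `θ` (Thm 2.11: finitely many zeros of the ideal `I_N` in the ball `B(θ, e^{-R(N)})`).

This file PROVES that this control is automatic (**Lemma CZ**, `roy_orbit_commonZeros_torsion`):
by Philippon's zero estimate on `𝔾ₐ × 𝔾ₘ` in the clean form `philippon_GaGm_one`
(`SoloBlindPhilipponGaGmOne.lean`, from the tree's PROVED `Philippon1986_GaGm_holds`), a point
`(y', α') ∈ ℂ^l × (ℂˣ)^l` at which *all* members `Q_{k,m}`, `k ≤ 2T`, `mⱼ ≤ 2K`, vanish has
`y' = 0` and every `α'ⱼ` a root of unity of order `≤ K`, as soon as `c D₀ < T+1`, `c D₁ < T+1`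
and `c D₀ D₁ < (T+1)(K+1)` — which hold for `T ≍ N^{s₀}`, `K ≍ N^{s₁}`, `Dᵢ = N^{tᵢ}` in Roy's
window (`royAdmissible_commonZero_exponents`: `t₀, t₁ < s₀`, `t₀ + t₁ < s₀ + s₁`). So the common
zeros of the orbit family form a finite set of torsion points at sup-distance `≥ max |yⱼ| > 0`
from `θ` (the `yⱼ` of the criterion are non-zero, being linearly independent over `ℚ`), and the
ball condition of Thm 2.11 holds with a *constant* radius function `R` (`roy_orbit_not_commonZero`).
Mechanism of the last step (`torsion_of_ncard_orbitBox_le`): Philippon's third alternative bounds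
the orbit box `Σ_K = {(m·y', α'^m) ; mⱼ ≤ K}` by `card Σ_K ≤ K`, and then on each coordinate axis
two of the `K+1` points `(a y'ⱼ, α'ⱼ^a)` coincide.

Consequence for the wall (`paper/wall.md` §3 (A′)): the obstruction to closing Roy's criterion by
Thm 2.11 is **not** its common-zero hypothesis but only its threshold `S ≥ C·τ·δ^{k}` at
codimension target `k = l - 1`, which in exponents demands
`u > max{s₀, s₁+t₁} + (l-1)·max{t₀, s₁+t₁}`; `royAdmissible_philippon_threshold_gap` PROVES that
this exceeds Roy's ceiling `u < (1+t₀+t₁)/2` by more than `1/2` for every `l ≥ 2` (for `l = 1`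
it is Roy's own floor `u > max{s₀, s₁+t₁}`, the Liouville level).
`royAdmissible_below_gelfond_scale` records the analogous gap for single-point measures of
Gel'fond type (`S ≫ δ(δ + log H)`).

References: D. Roy, *An arithmetic criterion for the values of the exponential function*, Acta
Arith. 97 (2001), Conjecture 2 and condition (1) [Roy2001]; P. Philippon, *Lemmes de zéros dans
les groupes algébriques commutatifs*, BSMF 114 (1986), Thm 2.1 [Philippon1986]; P. Philippon,
*Critères pour l'indépendance algébrique*, Publ. IHÉS 64 (1986), Thm 2.11 [Philippon1986Criteres];
M. Waldschmidt, *Diophantine Approximation on Linear Algebraic Groups*, Grundlehren 326 (2000),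
§8.1 (the zero estimate in this form) and §15 (criteria with multiplicities).
-/

noncomputable section

namespace Summit.Schanuel.Schanuel.Theorems

open Literature.NumberTheory.Transcendental GaGm MvPolynomial

variable {l : ℕ}

/-! ### Boxes `Σ_K = pt([0,K]^l)` of a monoid map `pt : ℕ^l → 𝔾ₐ × 𝔾ₘ` -/

/-- A box `Σ_K = {pt(m) ; 0 ≤ mⱼ ≤ K}` is finite. -/
theorem box_finite (pt : (Fin l → ℕ) → GaGm 1) (K : ℕ) :
    {g : GaGm 1 | ∃ m : Fin l → ℕ, (∀ j, m j ≤ K) ∧ g = pt m}.Finite := by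
  have hfin : {m : Fin l → ℕ | ∀ j, m j ≤ K}.Finite := by
    refine (Set.Finite.pi (t := fun _ : Fin l => Set.Iic K) fun _ => Set.finite_Iic K).subset ?_
    intro m hm
    exact Set.mem_univ_pi.mpr fun j => Set.mem_Iic.mpr (hm j)
  refine (hfin.image pt).subset ?_
  rintro g ⟨m, hm, rfl⟩
  exact ⟨m, hm, rfl⟩

/-- For an additive-to-multiplicative map, `Σ_K · Σ_K ⊆ Σ_{2K}`. -/
theorem sumset_two_box_subset (pt : (Fin l → ℕ) → GaGm 1)
    (hadd : ∀ m m', pt (m + m') = pt m * pt m') (K : ℕ) :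
    sumset {g : GaGm 1 | ∃ m : Fin l → ℕ, (∀ j, m j ≤ K) ∧ g = pt m} 2 ⊆
      {g : GaGm 1 | ∃ m : Fin l → ℕ, (∀ j, m j ≤ 2 * K) ∧ g = pt m} := by
  rintro g ⟨σ, hσ, rfl⟩
  obtain ⟨m₀, hm₀, h₀⟩ := hσ 0
  obtain ⟨m₁, hm₁, h₁⟩ := hσ 1
  refine ⟨m₀ + m₁, fun j => ?_, ?_⟩
  · have := hm₀ j
    have := hm₁ j
    simp only [Pi.add_apply]
    omega
  · rw [Fin.prod_univ_two, h₀, h₁, hadd]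

/-- **Pigeonhole ⇒ torsion.** If on the `j`-th axis `pt(n eⱼ) = (n y, a^n)` and the box `Σ_K` has
at most `K` points, then two of the `K + 1` axis points `0 ≤ n ≤ K` coincide: `y = 0` and `a` is a
root of unity of order `≤ K`. -/
theorem torsion_of_ncard_box_le (pt : (Fin l → ℕ) → GaGm 1) {K : ℕ} (j : Fin l) (y : ℂ) (a : ℂˣ)
    (hpt : ∀ n : ℕ, pt (Pi.single j n) = (Multiplicative.ofAdd ((n : ℂ) * y), fun _ => a ^ n))
    (hK : {g : GaGm 1 | ∃ m : Fin l → ℕ, (∀ i, m i ≤ K) ∧ g = pt m}.ncard ≤ K) :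
    y = 0 ∧ ∃ n, 0 < n ∧ n ≤ K ∧ a ^ n = 1 := by
  set f : Fin (K + 1) → GaGm 1 := fun i => pt (Pi.single j (i : ℕ)) with hf
  have hrange : Set.range f ⊆ {g : GaGm 1 | ∃ m : Fin l → ℕ, (∀ i, m i ≤ K) ∧ g = pt m} := by
    rintro g ⟨i, rfl⟩
    refine ⟨Pi.single j (i : ℕ), fun j' => ?_, rfl⟩
    rcases eq_or_ne j' j with rfl | hne
    · have := i.is_lt
      simp only [Pi.single_eq_same]
      omega
    · simp [Pi.single_eq_of_ne hne]
  have hnotinj : ¬ Function.Injective f := by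
    intro hinj
    have h1 : (Set.range f).ncard = K + 1 := by
      rw [Set.ncard_range_of_injective hinj, Nat.card_eq_fintype_card, Fintype.card_fin]
    have h2 :
        (Set.range f).ncard ≤ {g : GaGm 1 | ∃ m : Fin l → ℕ, (∀ i, m i ≤ K) ∧ g = pt m}.ncard :=
      Set.ncard_le_ncard hrange (box_finite pt K)
    omega
  obtain ⟨p, q, hpq, hne⟩ := Function.not_injective_iff.mp hnotinj
  simp only [hf, hpt, Prod.mk.injEq] at hpq
  obtain ⟨hpq1, hpq2⟩ := hpq
  have hy : ((p : ℕ) : ℂ) * y = ((q : ℕ) : ℂ) * y := by simpa using hpq1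
  have hα : a ^ (p : ℕ) = a ^ (q : ℕ) := congrFun hpq2 0
  have hne' : (p : ℕ) ≠ (q : ℕ) := fun h => hne (Fin.ext h)
  refine ⟨?_, ?_⟩
  · have hcast : ((p : ℕ) : ℂ) ≠ ((q : ℕ) : ℂ) := by exact_mod_cast hne'
    have : (((p : ℕ) : ℂ) - ((q : ℕ) : ℂ)) * y = 0 := by rw [sub_mul, hy, sub_self]
    rcases mul_eq_zero.mp this with h | h
    · exact absurd (sub_eq_zero.mp h) hcast
    · exact h
  · rcases Nat.lt_or_gt_of_ne hne' with hlt | hlt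
    · refine ⟨(q : ℕ) - p, Nat.sub_pos_of_lt hlt, ?_, ?_⟩
      · have := q.is_lt
        omega
      · have e : a ^ (q : ℕ) = a ^ (p : ℕ) * a ^ ((q : ℕ) - p) := by
          rw [← pow_add]
          congr 1
          omega
        rw [← hα] at e
        exact (mul_eq_left.mp e.symm)
    · refine ⟨(p : ℕ) - q, Nat.sub_pos_of_lt hlt, ?_, ?_⟩
      · have := p.is_lt
        omega
      · have e : a ^ (p : ℕ) = a ^ (q : ℕ) * a ^ ((p : ℕ) - q) := by
          rw [← pow_add]
          congr 1
          omega
        rw [hα] at e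
        exact (mul_eq_left.mp e.symm)

/-- **The orbit map** `m ↦ (∑ mⱼyⱼ, ∏ αⱼ^{mⱼ}) : ℕ^l → 𝔾ₐ × 𝔾ₘ` (Roy's points): its affine
coordinates, and the facts that it is a monoid map with `pt(n eⱼ) = (n yⱼ, αⱼ^n)` on the axes. -/
theorem exists_orbitMap (y : Fin l → ℂ) (α : Fin l → ℂˣ) :
    ∃ pt : (Fin l → ℕ) → GaGm 1,
      (∀ m, coord (pt m) = ![∑ j, (m j : ℂ) * y j, ∏ j, (α j : ℂ) ^ m j]) ∧ pt 0 = 1 ∧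
      (∀ m m', pt (m + m') = pt m * pt m') ∧
      ∀ (j : Fin l) (n : ℕ),
        pt (Pi.single j n) = (Multiplicative.ofAdd ((n : ℂ) * y j), fun _ => α j ^ n) := by
  refine ⟨fun m => (Multiplicative.ofAdd (∑ j, (m j : ℂ) * y j), fun _ => ∏ j, α j ^ m j),
    fun m => ?_, ?_, fun m m' => ?_, fun j n => ?_⟩
  · funext i
    refine Fin.cases ?_ (fun j => ?_) i
    · simp
    · rw [coord_succ, Subsingleton.elim j 0]
      simp
  · exact Prod.ext (by simp) (funext fun _ => by simp)
  · refine Prod.ext ?_ (funext fun _ => ?_)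
    · show Multiplicative.ofAdd _ = Multiplicative.ofAdd _ * Multiplicative.ofAdd _
      rw [← ofAdd_add]
      congr 1
      simp [Finset.sum_add_distrib, add_mul]
    · show (∏ j, α j ^ (m + m') j) = (∏ j, α j ^ m j) * ∏ j, α j ^ m' j
      rw [← Finset.prod_mul_distrib]
      exact Finset.prod_congr rfl fun j _ => by rw [Pi.add_apply, pow_add]
  · refine Prod.ext ?_ (funext fun _ => ?_)
    · show Multiplicative.ofAdd _ = Multiplicative.ofAdd _
      congr 1
      rw [Finset.sum_eq_single j (fun b _ hb => by simp [Pi.single_eq_of_ne hb]) (by simp)]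
      simp
    · show (∏ i, α i ^ (Pi.single j n : Fin l → ℕ) i) = α j ^ n
      rw [Finset.prod_eq_single j (fun b _ hb => by simp [Pi.single_eq_of_ne hb]) (by simp)]
      simp

/-! ### Lemma CZ -/

/-- **Lemma CZ (common zeros of Roy's orbit family are torsion points).** There is an absolute
constant `c` such that: if `P ∈ ℤ[X₀, X₁]` is non-zero of bidegree `≤ (D₀, D₁)`, `D₀, D₁ ≥ 1`,
and a point `(y', α') ∈ ℂ^l × (ℂˣ)^l` is a common zero of all
`Q_{k,m} = (D^k P)(∑ mⱼYⱼ, ∏ Aⱼ^{mⱼ})`, `k ≤ 2T`, `0 ≤ mⱼ ≤ 2K`, while `c D₀ < T + 1`,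
`c D₁ < T + 1` and `c D₀ D₁ < (T + 1)(K + 1)`, then `y' = 0` and every `α'ⱼ` is a root of unity of
order `≤ K`. In Roy's window (`T = ⌊N^{s₀}/2⌋`, `K = ⌊N^{s₁}/2⌋`, `D₀ = N^{t₀}`, `D₁ = N^{t₁}`) the
three numerical conditions hold for large `N` by `royAdmissible_commonZero_exponents`. -/
theorem roy_orbit_commonZeros_torsion :
    ∃ c : ℕ, ∀ (l K D₀ D₁ T : ℕ) (y : Fin l → ℂ) (α : Fin l → ℂˣ) (P : MvPolynomial (Fin 2) ℤ),
      P ≠ 0 → 1 ≤ D₀ → 1 ≤ D₁ → P.degreeOf 0 ≤ D₀ → P.degreeOf 1 ≤ D₁ →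
      (∀ (k : ℕ) (m : Fin l → ℕ), k ≤ 2 * T → (∀ j, m j ≤ 2 * K) →
        aeval ![∑ j, (m j : ℂ) * y j, ∏ j, (α j : ℂ) ^ m j] (royD^[k] P) = 0) →
      c * D₀ < T + 1 → c * D₁ < T + 1 → c * D₀ * D₁ < (T + 1) * (K + 1) →
      ∀ j, y j = 0 ∧ ∃ n, 0 < n ∧ n ≤ K ∧ α j ^ n = 1 := by
  obtain ⟨c, hc⟩ := philippon_GaGm_one
  refine ⟨c, fun l K D₀ D₁ T y α P hP hD₀ hD₁ hdeg0 hdeg1 hvan h0 h1 h2 j => ?_⟩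
  obtain ⟨pt, hcoord, hpt0, hadd, hsingle⟩ := exists_orbitMap y α
  set S : Set (GaGm 1) := {g : GaGm 1 | ∃ m : Fin l → ℕ, (∀ i, m i ≤ K) ∧ g = pt m} with hS
  set Pc : MvPolynomial (Fin 2) ℂ := map (Int.castRingHom ℂ) P with hPc
  have hPc0 : Pc ≠ 0 := by
    intro h
    apply hP
    apply map_injective (Int.castRingHom ℂ) Int.cast_injective
    rw [← hPc, h, map_zero]
  have hdeg0' : Pc.degreeOf 0 ≤ D₀ :=
    degreeOf_le_iff.mpr fun s hs => degreeOf_le_iff.mp hdeg0 s (support_map_subset _ _ hs)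
  have hdeg1' : Pc.degreeOf 1 ≤ D₁ :=
    degreeOf_le_iff.mpr fun s hs => degreeOf_le_iff.mp hdeg1 s (support_map_subset _ _ hs)
  have h1S : (1 : GaGm 1) ∈ S := ⟨0, fun _ => Nat.zero_le _, hpt0.symm⟩
  have hvan' : ∀ g ∈ sumset S 2,
      VanishesToOrder Pc (ℂ ∙ ((1 : ℂ), (1 : Fin 1 → ℂ))) g (2 * T + 1) := by
    intro g hg
    obtain ⟨m, hm, rfl⟩ := sumset_two_box_subset pt hadd K hg
    refine vanishesToOrder_royLine_of fun k hk => ?_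
    rw [hPc, ← map_royD_iterate, evalAt_map_int, hcoord]
    exact hvan k m (by omega) hm
  rcases hc D₀ D₁ T S Pc hD₀ hD₁ (box_finite pt K) h1S hPc0 hdeg0' hdeg1' hvan' with h | h | h
  · omega
  · omega
  · refine torsion_of_ncard_box_le pt j (y j) (α j) (hsingle j) (Nat.le_of_lt_succ ?_)
    by_contra hK
    push Not at hK
    have : (T + 1) * (K + 1) ≤ (T + 1) * S.ncard := Nat.mul_le_mul_left _ hK
    omega

/-- Corollary: at a point `(y, α)` with some `yⱼ ≠ 0` (e.g. `y` linearly independent over `ℚ` and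
`l ≥ 1`) the orbit family has no common zero — the members cannot *all* vanish there. -/
theorem roy_orbit_not_commonZero :
    ∃ c : ℕ, ∀ (l K D₀ D₁ T : ℕ) (y : Fin l → ℂ) (α : Fin l → ℂˣ) (P : MvPolynomial (Fin 2) ℤ),
      P ≠ 0 → 1 ≤ D₀ → 1 ≤ D₁ → P.degreeOf 0 ≤ D₀ → P.degreeOf 1 ≤ D₁ →
      c * D₀ < T + 1 → c * D₁ < T + 1 → c * D₀ * D₁ < (T + 1) * (K + 1) →
      (∃ j, y j ≠ 0) →
      ∃ (k : ℕ) (m : Fin l → ℕ), k ≤ 2 * T ∧ (∀ j, m j ≤ 2 * K) ∧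
        aeval ![∑ j, (m j : ℂ) * y j, ∏ j, (α j : ℂ) ^ m j] (royD^[k] P) ≠ 0 := by
  obtain ⟨c, hc⟩ := roy_orbit_commonZeros_torsion
  refine ⟨c, fun l K D₀ D₁ T y α P hP hD₀ hD₁ hdeg0 hdeg1 h0 h1 h2 ⟨j, hj⟩ => ?_⟩
  by_contra hall
  push Not at hall
  exact hj (hc l K D₀ D₁ T y α P hP hD₀ hD₁ hdeg0 hdeg1 hall h0 h1 h2 j).1

/-! ### Exponent bookkeeping in Roy's window -/

variable {s₀ s₁ t₀ t₁ u : ℝ}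

/-- The three numerical conditions of Lemma CZ hold for large `N` in Roy's window:
`t₀ < s₀`, `t₁ < s₀` (so `c N^{tᵢ} < N^{s₀}/2`) and `t₀ + t₁ < s₀ + s₁`
(so `c N^{t₀+t₁} < N^{s₀+s₁}/4`). -/
theorem royAdmissible_commonZero_exponents (h : RoyAdmissible s₀ s₁ t₀ t₁ u) :
    t₀ < s₀ ∧ t₁ < s₀ ∧ t₀ + t₁ < s₀ + s₁ := by
  obtain ⟨h0, h1, h2, h3, h4, g1, g2, g3, g4, g5, g6, k1, k2, k3⟩ := royAdmissible_unpack h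
  refine ⟨g2, ?_, ?_⟩ <;> linarith

/-- **The threshold gap.** Philippon's main criterion (IHÉS 1986, Thm 2.11) at codimension target
`k = l - 1` (to get `trdeg ≥ l`) needs `S ≥ C τ δ^{l-1}`; for the orbit family
`τ ≍ N^{max{s₀, s₁+t₁}}` (log-height `≍ N^{s₀} log N`, degree `≍ N^{max{t₀, s₁+t₁}}`) and
`S = N^u`, i.e. `u > max{s₀, s₁+t₁} + (l-1)·max{t₀, s₁+t₁}`. In Roy's window this fails by more
than `1/2` for every `l ≥ 2` (for `l = 1` it is Roy's floor `u > max{s₀, s₁+t₁}`). -/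
theorem royAdmissible_philippon_threshold_gap (h : RoyAdmissible s₀ s₁ t₀ t₁ u) {l : ℕ}
    (hl : 2 ≤ l) :
    u + 1 / 2 < max s₀ (s₁ + t₁) + ((l : ℝ) - 1) * max t₀ (s₁ + t₁) := by
  obtain ⟨h0, h1, h2, h3, h4, g1, g2, g3, g4, g5, g6, k1, k2, k3⟩ := royAdmissible_unpack h
  have hl' : (1 : ℝ) ≤ (l : ℝ) - 1 := by
    have : (2 : ℝ) ≤ (l : ℝ) := by exact_mod_cast hl
    linarith
  have a : s₀ ≤ max s₀ (s₁ + t₁) := le_max_left _ _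
  have b : s₁ + t₁ ≤ max t₀ (s₁ + t₁) := le_max_right _ _
  have hprod : s₁ + t₁ ≤ ((l : ℝ) - 1) * max t₀ (s₁ + t₁) := by
    calc s₁ + t₁ = 1 * (s₁ + t₁) := (one_mul _).symm
      _ ≤ ((l : ℝ) - 1) * max t₀ (s₁ + t₁) := mul_le_mul hl' b (by linarith) (by linarith)
  linarith

/-- **Gel'fond scale.** A single-point transcendence measure of Gel'fond–Brownawell type for the
smallest member `P_N(y, α)` of the family would need smallness `exp(-S)` with
`S ≫ δ (δ + log H) ≍ N^{t₀ + max{1, t₀}}`; Roy's `u` stays below that exponent by more than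
`1/2`. -/
theorem royAdmissible_below_gelfond_scale (h : RoyAdmissible s₀ s₁ t₀ t₁ u) :
    u + 1 / 2 < max 1 t₀ + t₀ := by
  obtain ⟨h0, h1, h2, h3, h4, g1, g2, g3, g4, g5, g6, k1, k2, k3⟩ := royAdmissible_unpack h
  rcases le_or_gt 1 t₀ with ht | ht
  · rw [max_eq_right ht]
    linarith
  · rw [max_eq_left ht.le]
    linarith

end Summit.Schanuel.Schanuel.Theorems
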